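import Summits.QuantumFields.YangMills.Theorems.UnitScaleTiltProp7Lane2CutoffCommutators
import HarnessLib

/-!
# Route `UnitScaleTilt`, crux «MinimiserStabilityRegPr» (stmt-QuantumFields-19200), E′ ∕ (N06) LANE II «DIVERGENCE RECOVERY AT CURVED `W`» — brick (B6), THE OVERLAP ROWS
# ([I-2](a)(c) of ★p1 g19's NAMER WORD №13): `‖Σ_c f_c‖² ≤ ν·Σ_c‖f_c‖²` for site ∕ bond families of pointwise multiplicity `≤ ν`, and the LOCAL-ENERGY version
# `H(Σ_c f_c) ≤ ν·Σ_c H(f_c)` for `H f := c₀ℓ²·CURL_HS(f) + ‖D*_W f‖²` when the 1-collared supports have multiplicity `≤ ν`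

Cell `ym3-torus`, width seat `ym3-torus-px11` (gen 6); NAMER WORD №13 [I-2] «EXPORTS asked of px11: (a) `norm_sq_sum_le_of_overlap` … SiteL2K and BondL2K versions → rows `Sr SM SL SK SΦ ≤ ν·Σ`;
(c) the local-energy overlap version `H(Σ_c f_c) ≤ ν·Σ_c H(f_c)` for `H f := c₀ℓ²·CURL_HS(f) + ‖DstarL2 W f‖²` (plaquette∕site-local PSD ⇒ same multiplicity argument)».  THEOREMS ONLY
(0 `def`, 0 `sorry`); `--supports stmt-QuantumFields-19200`, count-neutral.  YM₃ on T³ is a ladder rung (R3), not the Clay problem; nothing here claims (B7), (REC), `hN06`, a stub,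
the crux, d = 4 or the mass gap.

THE MECHANISM.  Pointwise Cauchy–Schwarz over the ALIVE members only (✓`Prop7CovAgmonLetters.hs_sum_le` on the filter `{c : f_c(x) ≠ 0}`, `Finset.sum_filter_ne_zero`), then the
`c₀`-weighted sums of ✓`norm_sq_toL2S` ∕ ✓`norm_sq_toL2`.  For the local energies: `curl_W` and `divB_W` are additive over finite families (lit ✓`B11Eq135Weitzenbock.covD_finset_sum`,
`R_finset_sum`), the curl at `p_{μν}(x)` reads the four bonds with sources `x, x+e_μ, x+e_ν` and the divergence at `x` the bonds with sources `x, x−e_μ` — all within one step of `x` —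
so a member whose 1-collared support set `Ω_c ∌ x` contributes nothing there, and the same filter argument runs with `{c : x ∈ Ω_c}`.
* §1 ★★ `norm_sq_sum_le_of_overlap_site` ∕ ★★ `norm_sq_sum_le_of_overlap_bond` — (a).
* §2 `curl_finset_sum` · `divB_finset_sum` · `curl_eq_zero_of_vanish` · `divB_eq_zero_of_vanish` (lattice, any units `U`); ★★★ `localEnergy_sum_le_of_overlap` — (c), in the engine's
  `CURL_HS` letters (`Σ_xΣ_μΣ_ν [μ<ν] hs(curl (torusT) (unitsField (toUField W)) …)`, prefactor `c₀·(L^{K−n})²`, as in ✓`curlHS_le_re_inner_DeltaEtaSlot`) plus `‖DstarL2 W ·‖²`.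
HONEST: finite Cauchy–Schwarz bookkeeping; nothing of (B7)∕(REC)∕hN06∕the crux is proved or claimed.

References: T. Bałaban, CMP 99 (1985) 389–434 [Balaban1985BackgroundPropagators] ((3.4) p.391, (3.8)–(3.11) p.392, (3.100) pp.413–414); CMP 96 (1984) 223–250 [Balaban1984PropagatorsII] (p.238).
-/

set_option autoImplicit false

noncomputable section

open scoped BigOperators Matrix.Norms.L2Operator Matrix

namespace Summit.QuantumFields.YangMills.Theorems.Prop7Lane2OverlapRows

open Literature.MathematicalPhysics.QuantumFieldTheory.Balaban1983to89
open Literature.MathematicalPhysics.QuantumFieldTheory.Balaban1983to89.T3ContinuumYM3Torus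
open T3SectALandauChart (bgUnits eta eta_pos)
open B10Eq27TorusAxialLog (unitsField toUField)
open B9Eq39Adjoint (R covD covDstar divB curl)
open B9TorusCalculus (torusT torusT_apply torusT_symm_apply)
open B10StarCount (shift_unshift unshift_shift)
open B11Eq103H1Complex (SiteL2K BondL2K)
open B11Eq135Weitzenbock (R_finset_sum covD_finset_sum)
open Summit.QuantumFields.YangMills.Theorems.Prop7SectET3Transport (periodsT3)
open Summit.QuantumFields.YangMills.Theorems.Prop7SectET3HilbertLetters (W₂ toL2 toL2S DL2 DstarL2)
open Summit.QuantumFields.YangMills.Theorems.Prop7LaplaceAFlatLetters (norm_sq_toL2 norm_sq_toL2S)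
open Summit.QuantumFields.YangMills.Theorems.Prop7DivSliceOfMemberDivSq (norm_sq_DstarL2_toL2_eq)
open Summit.QuantumFields.YangMills.Theorems.Prop7CovAgmonLetters (hs_sum_le)
open Finset

/-! ## §1 ★★ Norms of families with bounded pointwise multiplicity -/

section Norms

variable (F : T3Family) (K : ℕ) (c₀ : ℝ) [Fact (0 < c₀)]

/-- Pointwise: if at most `ν` of the matrices `Y_c` are non-zero, `hs(Σ_c Y_c) ≤ ν·Σ_c hs(Y_c)` (Cauchy–Schwarz over the alive members). [folklore] -/
theorem hs_sum_le_of_card_ne_zero {ι : Type*} (s : Finset ι) (Y : ι → Matrix (Fin 2) (Fin 2) ℂ) (ν : ℕ)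
    (hν : (s.filter (fun c => Y c ≠ 0)).card ≤ ν) :
    ∑ j : Fin 2, ∑ k : Fin 2, ‖(∑ c ∈ s, Y c) j k‖ ^ 2 ≤ ν * ∑ c ∈ s, ∑ j : Fin 2, ∑ k : Fin 2, ‖(Y c) j k‖ ^ 2 := by
  classical
  rw [← Finset.sum_filter_ne_zero s]
  refine (hs_sum_le (s.filter (fun c => Y c ≠ 0)) Y).trans ?_
  have h0 : ∀ c ∈ s, 0 ≤ ∑ j : Fin 2, ∑ k : Fin 2, ‖(Y c) j k‖ ^ 2 := fun c _ => by positivity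
  calc ((s.filter (fun c => Y c ≠ 0)).card : ℝ) * ∑ c ∈ s.filter (fun c => Y c ≠ 0), ∑ j : Fin 2, ∑ k : Fin 2, ‖(Y c) j k‖ ^ 2
      ≤ ν * ∑ c ∈ s.filter (fun c => Y c ≠ 0), ∑ j : Fin 2, ∑ k : Fin 2, ‖(Y c) j k‖ ^ 2 :=
        mul_le_mul_of_nonneg_right (by exact_mod_cast hν) (Finset.sum_nonneg fun c hc => h0 c (Finset.mem_of_mem_filter c hc))
    _ ≤ ν * ∑ c ∈ s, ∑ j : Fin 2, ∑ k : Fin 2, ‖(Y c) j k‖ ^ 2 :=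
        mul_le_mul_of_nonneg_left (Finset.sum_le_sum_of_subset_of_nonneg (Finset.filter_subset _ s) fun c hc _ => h0 c hc) (Nat.cast_nonneg ν)

/-- ★★ **(a), SITES**: for a finite family `f_c` of site fields with at most `ν` members non-zero at any site, `‖Σ_c f_c‖² ≤ ν·Σ_c ‖f_c‖²`.
[cite: Balaban1985BackgroundPropagators, (3.11) p.392, (3.100) pp.413–414] -/
theorem norm_sq_sum_le_of_overlap_site {ι : Type*} (s : Finset ι) (f : ι → SiteL2K ℂ 3 (periodsT3 F K) c₀ W₂) (ν : ℕ)
    (hν : ∀ x : Site (F.P K) 0, (s.filter (fun c => (toL2S F K c₀).symm (f c) x ≠ 0)).card ≤ ν) :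
    ‖∑ c ∈ s, f c‖ ^ 2 ≤ ν * ∑ c ∈ s, ‖f c‖ ^ 2 := by
  classical
  have hc₀ : (0 : ℝ) < c₀ := Fact.out
  have hsum : ∑ c ∈ s, f c = toL2S F K c₀ (fun x => ∑ c ∈ s, (toL2S F K c₀).symm (f c) x) := by
    apply (toL2S F K c₀).symm.injective
    rw [LinearEquiv.symm_apply_apply, map_sum]
    funext x
    exact Finset.sum_apply x s (fun c => (toL2S F K c₀).symm (f c))
  have hf : ∀ c, ‖f c‖ ^ 2 = c₀ * ∑ x : Site (F.P K) 0, ∑ i : Fin 2, ∑ i' : Fin 2, ‖(toL2S F K c₀).symm (f c) x i i'‖ ^ 2 := by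
    intro c
    conv_lhs => rw [← (toL2S F K c₀).apply_symm_apply (f c)]
    exact norm_sq_toL2S _
  rw [hsum, norm_sq_toL2S]
  simp only [hf]
  have hpt : ∀ x : Site (F.P K) 0, ∑ i : Fin 2, ∑ i' : Fin 2, ‖(∑ c ∈ s, (toL2S F K c₀).symm (f c) x) i i'‖ ^ 2
      ≤ ν * ∑ c ∈ s, ∑ i : Fin 2, ∑ i' : Fin 2, ‖((toL2S F K c₀).symm (f c) x) i i'‖ ^ 2 :=
    fun x => hs_sum_le_of_card_ne_zero s (fun c => (toL2S F K c₀).symm (f c) x) ν (hν x)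
  calc c₀ * ∑ x : Site (F.P K) 0, ∑ i : Fin 2, ∑ i' : Fin 2, ‖(∑ c ∈ s, (toL2S F K c₀).symm (f c) x) i i'‖ ^ 2
      ≤ c₀ * ∑ x : Site (F.P K) 0, (ν * ∑ c ∈ s, ∑ i : Fin 2, ∑ i' : Fin 2, ‖((toL2S F K c₀).symm (f c) x) i i'‖ ^ 2) :=
        mul_le_mul_of_nonneg_left (Finset.sum_le_sum fun x _ => hpt x) hc₀.le
    _ = ν * ∑ c ∈ s, (c₀ * ∑ x : Site (F.P K) 0, ∑ i : Fin 2, ∑ i' : Fin 2, ‖(toL2S F K c₀).symm (f c) x i i'‖ ^ 2) := by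
        rw [← Finset.mul_sum, Finset.sum_comm, ← Finset.mul_sum]
        ring

/-- ★★ **(a), BONDS**: for a finite family `f_c` of bond fields with at most `ν` members non-zero at any bond, `‖Σ_c f_c‖² ≤ ν·Σ_c ‖f_c‖²`.
[cite: Balaban1985BackgroundPropagators, (3.11) p.392, (3.100) pp.413–414] -/
theorem norm_sq_sum_le_of_overlap_bond {ι : Type*} (s : Finset ι) (f : ι → BondL2K ℂ 3 (periodsT3 F K) c₀ W₂) (ν : ℕ)
    (hν : ∀ b : PBond (F.P K) 0, (s.filter (fun c => (toL2 F K c₀).symm (f c) b ≠ 0)).card ≤ ν) :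
    ‖∑ c ∈ s, f c‖ ^ 2 ≤ ν * ∑ c ∈ s, ‖f c‖ ^ 2 := by
  classical
  have hc₀ : (0 : ℝ) < c₀ := Fact.out
  have hsum : ∑ c ∈ s, f c = toL2 F K c₀ (fun b => ∑ c ∈ s, (toL2 F K c₀).symm (f c) b) := by
    apply (toL2 F K c₀).symm.injective
    rw [LinearEquiv.symm_apply_apply, map_sum]
    funext b
    exact Finset.sum_apply b s (fun c => (toL2 F K c₀).symm (f c))
  have hf : ∀ c, ‖f c‖ ^ 2 = c₀ * ∑ b : PBond (F.P K) 0, ∑ i : Fin 2, ∑ i' : Fin 2, ‖(toL2 F K c₀).symm (f c) b i i'‖ ^ 2 := by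
    intro c
    conv_lhs => rw [← (toL2 F K c₀).apply_symm_apply (f c)]
    exact norm_sq_toL2 _
  rw [hsum, norm_sq_toL2]
  simp only [hf]
  have hpt : ∀ b : PBond (F.P K) 0, ∑ i : Fin 2, ∑ i' : Fin 2, ‖(∑ c ∈ s, (toL2 F K c₀).symm (f c) b) i i'‖ ^ 2
      ≤ ν * ∑ c ∈ s, ∑ i : Fin 2, ∑ i' : Fin 2, ‖((toL2 F K c₀).symm (f c) b) i i'‖ ^ 2 :=
    fun b => hs_sum_le_of_card_ne_zero s (fun c => (toL2 F K c₀).symm (f c) b) ν (hν b)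
  calc c₀ * ∑ b : PBond (F.P K) 0, ∑ i : Fin 2, ∑ i' : Fin 2, ‖(∑ c ∈ s, (toL2 F K c₀).symm (f c) b) i i'‖ ^ 2
      ≤ c₀ * ∑ b : PBond (F.P K) 0, (ν * ∑ c ∈ s, ∑ i : Fin 2, ∑ i' : Fin 2, ‖((toL2 F K c₀).symm (f c) b) i i'‖ ^ 2) :=
        mul_le_mul_of_nonneg_left (Finset.sum_le_sum fun b _ => hpt b) hc₀.le
    _ = ν * ∑ c ∈ s, (c₀ * ∑ b : PBond (F.P K) 0, ∑ i : Fin 2, ∑ i' : Fin 2, ‖(toL2 F K c₀).symm (f c) b i i'‖ ^ 2) := by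
        rw [← Finset.mul_sum, Finset.sum_comm, ← Finset.mul_sum]
        ring

end Norms

/-! ## §2 ★★★ Local energies of families with bounded collared multiplicity -/

section Lattice

variable {P : Params} {N : ℕ} (U : Fin P.d → Site P 0 → (Matrix (Fin N) (Fin N) ℂ)ˣ)

/-- The covariant curl is additive over finite families of one-forms. [cite: Balaban1985BackgroundPropagators, (3.4) p.391] -/
theorem curl_finset_sum {ι : Type*} (s : Finset ι) (A : ι → Fin P.d → Site P 0 → Matrix (Fin N) (Fin N) ℂ) (μ ν : Fin P.d) (x : Site P 0) :
    curl (torusT P 0) U (fun κ z => ∑ c ∈ s, A c κ z) μ ν x = ∑ c ∈ s, curl (torusT P 0) U (A c) μ ν x := by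
  simp only [curl, covD, R_finset_sum, Finset.sum_sub_distrib]

/-- `D*_μ` is additive over finite families. [cite: Balaban1985BackgroundPropagators, (3.8) p.392] -/
theorem covDstar_finset_sum' {ι : Type*} (s : Finset ι) (μ : Fin P.d) (g : ι → Site P 0 → Matrix (Fin N) (Fin N) ℂ) (x : Site P 0) :
    covDstar (torusT P 0) U μ (fun z => ∑ c ∈ s, g c z) x = ∑ c ∈ s, covDstar (torusT P 0) U μ (g c) x := by
  simp only [covDstar, R_finset_sum, Finset.sum_sub_distrib]

/-- The covariant divergence is additive over finite families of one-forms. [cite: Balaban1985BackgroundPropagators, (3.8) p.392] -/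
theorem divB_finset_sum {ι : Type*} (s : Finset ι) (A : ι → Fin P.d → Site P 0 → Matrix (Fin N) (Fin N) ℂ) (x : Site P 0) :
    divB (torusT P 0) U (fun κ z => ∑ c ∈ s, A c κ z) x = ∑ c ∈ s, divB (torusT P 0) U (A c) x := by
  simp only [divB]
  rw [Finset.sum_comm]
  exact Finset.sum_congr rfl fun μ _ => covDstar_finset_sum' U s μ (fun c z => A c μ z) x

/-- A one-form vanishing on the four bonds of `p_{μν}(x)` (sources `x`, `x+e_μ`, `x+e_ν`) has zero covariant curl there. [cite: Balaban1985BackgroundPropagators, (3.4) p.391] -/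
theorem curl_eq_zero_of_vanish (A : Fin P.d → Site P 0 → Matrix (Fin N) (Fin N) ℂ) (μ ν : Fin P.d) (x : Site P 0)
    (h1 : A ν x = 0) (h2 : A μ x = 0) (h3 : A ν (x.shift μ) = 0) (h4 : A μ (x.shift ν) = 0) :
    curl (torusT P 0) U A μ ν x = 0 := by
  simp only [curl, covD, torusT_apply, h1, h2, h3, h4, B9Eq39Adjoint.R_def, mul_zero, zero_mul, sub_zero]

/-- A one-form vanishing on the bonds `⟨x, μ⟩` and `⟨x−e_μ, μ⟩` for all `μ` has zero covariant divergence at `x`. [cite: Balaban1985BackgroundPropagators, (3.8) p.392] -/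
theorem divB_eq_zero_of_vanish (A : Fin P.d → Site P 0 → Matrix (Fin N) (Fin N) ℂ) (x : Site P 0)
    (h1 : ∀ μ, A μ x = 0) (h2 : ∀ μ, A μ (x.unshift μ) = 0) :
    divB (torusT P 0) U A x = 0 := by
  refine Finset.sum_eq_zero fun μ _ => ?_
  simp only [covDstar, torusT_symm_apply, h1 μ, h2 μ, B9Eq39Adjoint.R_def, mul_zero, zero_mul, sub_zero]

end Lattice

section Member

variable (F : T3Family) (n K : ℕ) (c₀ : ℝ) [Fact (0 < c₀)]

/-- ★★★ **(c) THE LOCAL-ENERGY OVERLAP ROW**: for `H f := c₀·(L^{K−n})²·CURL_HS(f) + ‖DstarL2 W f‖²` (`CURL_HS` in the engine's letters) and a finite family of bond fields `f_c`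
whose 1-COLLARED supports lie in sets `Ω_c` (`f_c(b) ≠ 0 ⇒ b₋, b₋ ± e_μ ∈ Ω_c`) of multiplicity `#{c : x ∈ Ω_c} ≤ ν` at every site, `H(Σ_c f_c) ≤ ν·Σ_c H(f_c)`.
[cite: Balaban1985BackgroundPropagators, (3.4) p.391, (3.8)–(3.11) p.392, (3.100) pp.413–414] -/
theorem localEnergy_sum_le_of_overlap (W : GaugeField (F.P K) 0 (Matrix.specialUnitaryGroup (Fin 2) ℂ)) {ι : Type*} (s : Finset ι)
    (f : ι → BondL2K ℂ 3 (periodsT3 F K) c₀ W₂) (Ω : ι → Finset (Site (F.P K) 0)) (ν : ℕ)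
    (hsupp : ∀ (c : ι) (b : PBond (F.P K) 0), (toL2 F K c₀).symm (f c) b ≠ 0 →
      b.src ∈ Ω c ∧ ∀ μ : Fin (F.P K).d, b.src.shift μ ∈ Ω c ∧ b.src.unshift μ ∈ Ω c)
    (hν : ∀ x : Site (F.P K) 0, (s.filter (fun c => x ∈ Ω c)).card ≤ ν) :
    c₀ * ((F.L : ℝ) ^ (K - n)) ^ 2 * (∑ x : Site (F.P K) 0, ∑ μ : Fin (F.P K).d, ∑ ν' : Fin (F.P K).d,
        (if μ < ν' then ∑ j : Fin 2, ∑ k : Fin 2,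
          ‖(curl (torusT (F.P K) 0) (fun κ z => unitsField (toUField W) ⟨z, κ⟩)
            (fun κ z => (toL2 F K c₀).symm (∑ c ∈ s, f c) ⟨z, κ⟩) μ ν' x) j k‖ ^ 2 else 0))
      + ‖DstarL2 F n K c₀ W (∑ c ∈ s, f c)‖ ^ 2
    ≤ ν * ∑ c ∈ s, (c₀ * ((F.L : ℝ) ^ (K - n)) ^ 2 * (∑ x : Site (F.P K) 0, ∑ μ : Fin (F.P K).d, ∑ ν' : Fin (F.P K).d,
        (if μ < ν' then ∑ j : Fin 2, ∑ k : Fin 2,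
          ‖(curl (torusT (F.P K) 0) (fun κ z => unitsField (toUField W) ⟨z, κ⟩)
            (fun κ z => (toL2 F K c₀).symm (f c) ⟨z, κ⟩) μ ν' x) j k‖ ^ 2 else 0))
      + ‖DstarL2 F n K c₀ W (f c)‖ ^ 2) := by
  classical
  have hc₀ : (0 : ℝ) < c₀ := Fact.out
  have hk : 0 ≤ c₀ * ((F.L : ℝ) ^ (K - n)) ^ 2 := by positivity
  set Uu : Fin (F.P K).d → Site (F.P K) 0 → (Matrix (Fin 2) (Fin 2) ℂ)ˣ := fun κ z => unitsField (toUField W) ⟨z, κ⟩ with hUu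
  -- the summed field in lattice letters (`A c κ z := (toL2)⁻¹ (f c) ⟨z, κ⟩`)
  have hsumA : (fun κ z => (toL2 F K c₀).symm (∑ c ∈ s, f c) ⟨z, κ⟩)
      = fun κ z => ∑ c ∈ s, (fun (c : ι) (κ : Fin (F.P K).d) (z : Site (F.P K) 0) => (toL2 F K c₀).symm (f c) ⟨z, κ⟩) c κ z := by
    funext κ z
    rw [map_sum, Finset.sum_apply]
  have hsumT : ∑ c ∈ s, f c = toL2 F K c₀ (fun b => ∑ c ∈ s, (fun (c : ι) (κ : Fin (F.P K).d) (z : Site (F.P K) 0) => (toL2 F K c₀).symm (f c) ⟨z, κ⟩) c b.dir b.src) := by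
    apply (toL2 F K c₀).symm.injective
    rw [LinearEquiv.symm_apply_apply, map_sum]
    funext b
    exact Finset.sum_apply b s (fun c => (toL2 F K c₀).symm (f c))
  have hfT : ∀ c, f c = toL2 F K c₀ (fun b => (fun (c : ι) (κ : Fin (F.P K).d) (z : Site (F.P K) 0) => (toL2 F K c₀).symm (f c) ⟨z, κ⟩) c b.dir b.src) := by
    intro c
    apply (toL2 F K c₀).symm.injective
    rw [LinearEquiv.symm_apply_apply]
  -- off `Ω_c` the member `c` vanishes on every bond within one step
  have hzero : ∀ (c : ι) (x : Site (F.P K) 0), x ∉ Ω c →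
      (∀ μ, (fun (c : ι) (κ : Fin (F.P K).d) (z : Site (F.P K) 0) => (toL2 F K c₀).symm (f c) ⟨z, κ⟩) c μ x = 0) ∧ (∀ μ κ, (fun (c : ι) (κ : Fin (F.P K).d) (z : Site (F.P K) 0) => (toL2 F K c₀).symm (f c) ⟨z, κ⟩) c κ (x.shift μ) = 0) ∧ (∀ μ, (fun (c : ι) (κ : Fin (F.P K).d) (z : Site (F.P K) 0) => (toL2 F K c₀).symm (f c) ⟨z, κ⟩) c μ (x.unshift μ) = 0) := by
    intro c x hx
    refine ⟨fun μ => ?_, fun μ κ => ?_, fun μ => ?_⟩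
    · by_contra h
      exact hx (hsupp c ⟨x, μ⟩ h).1
    · by_contra h
      have := ((hsupp c ⟨x.shift μ, κ⟩ h).2 μ).2
      rw [show (⟨x.shift μ, κ⟩ : PBond (F.P K) 0).src = x.shift μ from rfl, unshift_shift] at this
      exact hx this
    · by_contra h
      have := ((hsupp c ⟨x.unshift μ, μ⟩ h).2 μ).1
      rw [show (⟨x.unshift μ, μ⟩ : PBond (F.P K) 0).src = x.unshift μ from rfl, shift_unshift] at this
      exact hx this
  -- CURL part, pointwise
  have hcurl : ∀ (x : Site (F.P K) 0) (μ ν' : Fin (F.P K).d),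
      ∑ j : Fin 2, ∑ k : Fin 2, ‖(curl (torusT (F.P K) 0) Uu (fun κ z => ∑ c ∈ s, (fun (c : ι) (κ : Fin (F.P K).d) (z : Site (F.P K) 0) => (toL2 F K c₀).symm (f c) ⟨z, κ⟩) c κ z) μ ν' x) j k‖ ^ 2
        ≤ ν * ∑ c ∈ s, ∑ j : Fin 2, ∑ k : Fin 2, ‖(curl (torusT (F.P K) 0) Uu ((fun (c : ι) (κ : Fin (F.P K).d) (z : Site (F.P K) 0) => (toL2 F K c₀).symm (f c) ⟨z, κ⟩) c) μ ν' x) j k‖ ^ 2 := by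
    intro x μ ν'
    rw [curl_finset_sum Uu s (fun (c : ι) (κ : Fin (F.P K).d) (z : Site (F.P K) 0) => (toL2 F K c₀).symm (f c) ⟨z, κ⟩) μ ν' x]
    refine hs_sum_le_of_card_ne_zero s _ ν ((Finset.card_le_card ?_).trans (hν x))
    intro c hc
    rw [Finset.mem_filter] at hc ⊢
    refine ⟨hc.1, ?_⟩
    by_contra hx
    obtain ⟨h1, h2, -⟩ := hzero c x hx
    exact hc.2 (curl_eq_zero_of_vanish Uu ((fun (c : ι) (κ : Fin (F.P K).d) (z : Site (F.P K) 0) => (toL2 F K c₀).symm (f c) ⟨z, κ⟩) c) μ ν' x (h1 ν') (h1 μ) (h2 μ ν') (h2 ν' μ))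
  -- DIV part, pointwise
  have hdiv : ∀ x : Site (F.P K) 0,
      ∑ j : Fin 2, ∑ k : Fin 2, ‖(divB (torusT (F.P K) 0) Uu (fun κ z => ∑ c ∈ s, (fun (c : ι) (κ : Fin (F.P K).d) (z : Site (F.P K) 0) => (toL2 F K c₀).symm (f c) ⟨z, κ⟩) c κ z) x) j k‖ ^ 2
        ≤ ν * ∑ c ∈ s, ∑ j : Fin 2, ∑ k : Fin 2, ‖(divB (torusT (F.P K) 0) Uu ((fun (c : ι) (κ : Fin (F.P K).d) (z : Site (F.P K) 0) => (toL2 F K c₀).symm (f c) ⟨z, κ⟩) c) x) j k‖ ^ 2 := by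
    intro x
    rw [divB_finset_sum Uu s (fun (c : ι) (κ : Fin (F.P K).d) (z : Site (F.P K) 0) => (toL2 F K c₀).symm (f c) ⟨z, κ⟩) x]
    refine hs_sum_le_of_card_ne_zero s _ ν ((Finset.card_le_card ?_).trans (hν x))
    intro c hc
    rw [Finset.mem_filter] at hc ⊢
    refine ⟨hc.1, ?_⟩
    by_contra hx
    obtain ⟨h1, -, h3⟩ := hzero c x hx
    exact hc.2 (divB_eq_zero_of_vanish Uu ((fun (c : ι) (κ : Fin (F.P K).d) (z : Site (F.P K) 0) => (toL2 F K c₀).symm (f c) ⟨z, κ⟩) c) x h1 h3)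
  -- the `if`-weighted curl sums
  have hite : ∀ (x : Site (F.P K) 0) (μ ν' : Fin (F.P K).d),
      (if μ < ν' then ∑ j : Fin 2, ∑ k : Fin 2, ‖(curl (torusT (F.P K) 0) Uu (fun κ z => ∑ c ∈ s, (fun (c : ι) (κ : Fin (F.P K).d) (z : Site (F.P K) 0) => (toL2 F K c₀).symm (f c) ⟨z, κ⟩) c κ z) μ ν' x) j k‖ ^ 2 else 0)
        ≤ ν * ∑ c ∈ s, (if μ < ν' then ∑ j : Fin 2, ∑ k : Fin 2, ‖(curl (torusT (F.P K) 0) Uu ((fun (c : ι) (κ : Fin (F.P K).d) (z : Site (F.P K) 0) => (toL2 F K c₀).symm (f c) ⟨z, κ⟩) c) μ ν' x) j k‖ ^ 2 else 0) := by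
    intro x μ ν'
    split_ifs with h
    · exact hcurl x μ ν'
    · simp
  have hC : ∑ x : Site (F.P K) 0, ∑ μ : Fin (F.P K).d, ∑ ν' : Fin (F.P K).d,
        (if μ < ν' then ∑ j : Fin 2, ∑ k : Fin 2, ‖(curl (torusT (F.P K) 0) Uu (fun κ z => ∑ c ∈ s, (fun (c : ι) (κ : Fin (F.P K).d) (z : Site (F.P K) 0) => (toL2 F K c₀).symm (f c) ⟨z, κ⟩) c κ z) μ ν' x) j k‖ ^ 2 else 0)
      ≤ ν * ∑ c ∈ s, ∑ x : Site (F.P K) 0, ∑ μ : Fin (F.P K).d, ∑ ν' : Fin (F.P K).d,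
        (if μ < ν' then ∑ j : Fin 2, ∑ k : Fin 2, ‖(curl (torusT (F.P K) 0) Uu ((fun (c : ι) (κ : Fin (F.P K).d) (z : Site (F.P K) 0) => (toL2 F K c₀).symm (f c) ⟨z, κ⟩) c) μ ν' x) j k‖ ^ 2 else 0) := by
    calc _ ≤ ∑ x : Site (F.P K) 0, ∑ μ : Fin (F.P K).d, ∑ ν' : Fin (F.P K).d,
          ν * ∑ c ∈ s, (if μ < ν' then ∑ j : Fin 2, ∑ k : Fin 2, ‖(curl (torusT (F.P K) 0) Uu ((fun (c : ι) (κ : Fin (F.P K).d) (z : Site (F.P K) 0) => (toL2 F K c₀).symm (f c) ⟨z, κ⟩) c) μ ν' x) j k‖ ^ 2 else 0) :=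
          Finset.sum_le_sum fun x _ => Finset.sum_le_sum fun μ _ => Finset.sum_le_sum fun ν' _ => hite x μ ν'
      _ = _ := by
          simp only [← Finset.mul_sum]
          congr 1
          refine (Finset.sum_congr rfl fun x _ => ?_).trans Finset.sum_comm
          exact (Finset.sum_congr rfl fun μ _ => Finset.sum_comm).trans Finset.sum_comm
  -- DIV norms
  have hc : ∀ c, ‖DstarL2 F n K c₀ W (f c)‖ ^ 2 = c₀ * ((F.L : ℝ) ^ (K - n)) ^ 2 *
      ∑ x : Site (F.P K) 0, ∑ j : Fin 2, ∑ k : Fin 2, ‖(divB (torusT (F.P K) 0) Uu ((fun (c : ι) (κ : Fin (F.P K).d) (z : Site (F.P K) 0) => (toL2 F K c₀).symm (f c) ⟨z, κ⟩) c) x) j k‖ ^ 2 := by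
    intro c
    conv_lhs => rw [hfT c]
    exact norm_sq_DstarL2_toL2_eq F n K c₀ W _
  have hD : ‖DstarL2 F n K c₀ W (∑ c ∈ s, f c)‖ ^ 2 ≤ ν * ∑ c ∈ s, ‖DstarL2 F n K c₀ W (f c)‖ ^ 2 := by
    rw [hsumT, norm_sq_DstarL2_toL2_eq F n K c₀ W]
    show c₀ * ((F.L : ℝ) ^ (K - n)) ^ 2 * ∑ x : Site (F.P K) 0, ∑ j : Fin 2, ∑ k : Fin 2,
        ‖(divB (torusT (F.P K) 0) Uu (fun κ z => ∑ c ∈ s, (fun (c : ι) (κ : Fin (F.P K).d) (z : Site (F.P K) 0) => (toL2 F K c₀).symm (f c) ⟨z, κ⟩) c κ z) x) j k‖ ^ 2 ≤ _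
    simp only [hc]
    calc c₀ * ((F.L : ℝ) ^ (K - n)) ^ 2 * ∑ x : Site (F.P K) 0, ∑ j : Fin 2, ∑ k : Fin 2,
          ‖(divB (torusT (F.P K) 0) Uu (fun κ z => ∑ c ∈ s, (fun (c : ι) (κ : Fin (F.P K).d) (z : Site (F.P K) 0) => (toL2 F K c₀).symm (f c) ⟨z, κ⟩) c κ z) x) j k‖ ^ 2
        ≤ c₀ * ((F.L : ℝ) ^ (K - n)) ^ 2 * ∑ x : Site (F.P K) 0,
            (ν * ∑ c ∈ s, ∑ j : Fin 2, ∑ k : Fin 2, ‖(divB (torusT (F.P K) 0) Uu ((fun (c : ι) (κ : Fin (F.P K).d) (z : Site (F.P K) 0) => (toL2 F K c₀).symm (f c) ⟨z, κ⟩) c) x) j k‖ ^ 2) :=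
          mul_le_mul_of_nonneg_left (Finset.sum_le_sum fun x _ => hdiv x) hk
      _ = ν * ∑ c ∈ s, (c₀ * ((F.L : ℝ) ^ (K - n)) ^ 2 *
            ∑ x : Site (F.P K) 0, ∑ j : Fin 2, ∑ k : Fin 2, ‖(divB (torusT (F.P K) 0) Uu ((fun (c : ι) (κ : Fin (F.P K).d) (z : Site (F.P K) 0) => (toL2 F K c₀).symm (f c) ⟨z, κ⟩) c) x) j k‖ ^ 2) := by
          rw [← Finset.mul_sum, Finset.sum_comm, ← Finset.mul_sum]
          ring
  -- assemble
  rw [hsumA]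
  beta_reduce
  beta_reduce at hC
  calc c₀ * ((F.L : ℝ) ^ (K - n)) ^ 2 * (∑ x : Site (F.P K) 0, ∑ μ : Fin (F.P K).d, ∑ ν' : Fin (F.P K).d,
          (if μ < ν' then ∑ j : Fin 2, ∑ k : Fin 2,
            ‖(curl (torusT (F.P K) 0) Uu (fun κ z => ∑ c ∈ s, (toL2 F K c₀).symm (f c) ⟨z, κ⟩) μ ν' x) j k‖ ^ 2 else 0))
        + ‖DstarL2 F n K c₀ W (∑ c ∈ s, f c)‖ ^ 2
      ≤ c₀ * ((F.L : ℝ) ^ (K - n)) ^ 2 * (ν * ∑ c ∈ s, ∑ x : Site (F.P K) 0, ∑ μ : Fin (F.P K).d, ∑ ν' : Fin (F.P K).d,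
          (if μ < ν' then ∑ j : Fin 2, ∑ k : Fin 2,
            ‖(curl (torusT (F.P K) 0) Uu (fun κ z => (toL2 F K c₀).symm (f c) ⟨z, κ⟩) μ ν' x) j k‖ ^ 2 else 0))
        + ν * ∑ c ∈ s, ‖DstarL2 F n K c₀ W (f c)‖ ^ 2 := add_le_add (mul_le_mul_of_nonneg_left hC hk) hD
    _ = _ := by
        rw [Finset.sum_add_distrib, mul_add, ← Finset.mul_sum]
        ring

end Member

end Summit.QuantumFields.YangMills.Theorems.Prop7Lane2OverlapRows

end
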